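import Summits.AnomalousDissipation.AnomalousDissipation.Theses.RootDecompCycle2B
import Literature.Analysis.FluidPDE.LerayHopfSpectralMeasurability
import Literature.Analysis.FluidPDE.LongTimeAverageSubadditive
import Literature.Analysis.FluidPDE.TimeAverageEnstrophy
import Literature.Analysis.FluidPDE.LerayHopfMomentum
import Literature.Analysis.FunctionSpaces.TorusTruncationH1
import Literature.Analysis.FluidPDE.LerayHopfRestartTorus
import Literature.Analysis.FluidPDE.LongTimeAverageShift
import Literature.Analysis.FluidPDE.LerayHopfUniformEnergyMomentum

/-!
# `RootDecompCycle2B.WindowBookkeeping` (stmt-AnomalousDissipation-26354) is a theorem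

The support item W of route `route-AnomalousDissipation-RootDecompCycle2B` (shared with RootDecompCycle2C and the lens-5
child routes): a WINDOWED zeroth law — one fixed smooth force, `ν_j → 0`, and for all large `j` a capped global Leray–Hopf run
whose running-mean energy is eventually `≤ E` and whose RESOLVED running-mean dissipation `ν_j‖∇P_{K(T)} u(t)‖²` exceeds `ε` at
arbitrarily late horizons — implies `AnomalousDissipation`.  Proof (lens-5 gen-2, re-targeted at the tree decl): re-index
`j ↦ j + j₀`; an eventual bound on the running means is a bound on their `limsup` (`meanEnergy`); loud resolved horizons
`T → ∞` give `limsup ≥ ε` for the TOTAL running-mean dissipation, because the resolved dissipation is dominated by the total one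
(`eGradNormSq_eq_add_fourierTruncate`) and the total running means are bounded (`IsGlobalLerayHopf.isBoundedUnder_timeMean_dissipation`).
Every ingredient is a tree lemma; no facts asserted.
Source: decomp-ad cell, lens-5 node «ClimateLanding» (kernel `run/shared/lean/pub/decomp-ad/decomp-ad-lens-5/ClimateLanding.lean`,
theorems `windowBookkeeping_holds` / `timeMean_resolvedDissipation_le`, by name against the tree); landed by the cell's prover seat
with the kernel's `resolvedDissipation` abbreviation inlined.  Nothing here proves the summit.
-/

set_option linter.dupNamespace false

noncomputable section

namespace Summit.AnomalousDissipation.AnomalousDissipation.Theorems.WindowBookkeeping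

open MeasureTheory Filter Topology Set
open scoped InnerProductSpace
open Literature.Analysis.FunctionSpaces Literature.Analysis.FluidPDE
open Summit.AnomalousDissipation.AnomalousDissipation.Theses

/-- Along a global Leray–Hopf run, the running mean of the RESOLVED dissipation `ν‖∇P_N u(t)‖²` is at most the running mean
of the total dissipation `ν‖∇u(t)‖²` on every horizon `T > 0`. [folklore] -/
theorem timeMean_resolvedDissipation_le {ν : ℝ} (hν : 0 ≤ ν) {f u₀ : UnitAddTorus (Fin 3) → EuclideanSpace ℝ (Fin 3)}
    {u : ℝ → UnitAddTorus (Fin 3) → EuclideanSpace ℝ (Fin 3)}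
    (hu : Torus.IsGlobalLerayHopf ν (fun _ => f) u₀ u) (N : ℕ) {T : ℝ} (hT : 0 < T) :
    timeMean (fun t => ν * (Torus.eGradNormSq (Torus.fourierTruncate N (u t))).toReal) T ≤
      timeMean (fun t => ν * (Torus.eGradNormSq (u t)).toReal) T := by
  have hLH := hu T hT
  have hres : IntegrableOn (fun t => ν * (Torus.eGradNormSq (Torus.fourierTruncate N (u t))).toReal) (Ioc 0 T) :=
    ((hLH.tendsto_setIntegral_toReal_eGradNormSq_fourierTruncate (t := T) ⟨hT, le_rfl⟩).1 N).const_mul ν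
  have htot : IntegrableOn (fun t => ν * (Torus.eGradNormSq (u t)).toReal) (Ioc 0 T) :=
    (hu.integrableOn_toReal_eGradNormSq hT).1.const_mul ν
  have hlt : ∀ᵐ t ∂(volume.restrict (Ioc 0 T)), Torus.eGradNormSq (u t) < ⊤ := by
    rw [← Measure.restrict_congr_set (Ioo_ae_eq_Ioc (μ := volume) (a := (0 : ℝ)) (b := T))]
    exact ae_lt_top' hLH.aemeasurable_eGradNormSq hLH.lintegral_eGradNormSq_lt_top.ne
  have hmem : ∀ᵐ t ∂(volume.restrict (Ioc 0 T)), t ∈ Ioc 0 T := ae_restrict_mem measurableSet_Ioc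
  have hle : (fun t => ν * (Torus.eGradNormSq (Torus.fourierTruncate N (u t))).toReal) ≤ᵐ[volume.restrict (Ioc 0 T)]
      fun t => ν * (Torus.eGradNormSq (u t)).toReal := by
    filter_upwards [hlt, hmem] with t ht htm
    have hint : Integrable (u t) volume :=
      (hLH.memLp t ⟨htm.1.le, htm.2⟩).integrable one_le_two
    have hmono : Torus.eGradNormSq (Torus.fourierTruncate N (u t)) ≤ Torus.eGradNormSq (u t) := by
      rw [Torus.eGradNormSq_eq_add_fourierTruncate hint N]
      exact le_self_add
    exact mul_le_mul_of_nonneg_left (ENNReal.toReal_mono ht.ne hmono) hν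
  unfold timeMean
  rw [intervalIntegral.integral_of_le hT.le, intervalIntegral.integral_of_le hT.le]
  exact mul_le_mul_of_nonneg_left (setIntegral_mono_ae_restrict hres htot hle) (inv_nonneg.2 hT.le)

/-- **Item 26354 `RootDecompCycle2B.WindowBookkeeping` holds**: a windowed zeroth law (capped runs, eventually bounded
running-mean energy, loud resolved running means at arbitrarily late horizons, for all large `j`) gives the zeroth law, by
re-indexing `j ↦ j + j₀` and passing from eventual / frequent running-mean bounds to `limsup` means. [folklore] -/
theorem windowBookkeeping_holds : RootDecompCycle2B.WindowBookkeeping := by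
  rintro ⟨f, ν, E₀, E, ε, ⟨hf, hdiv, hmean, hν, hν0, hε⟩, j₀, hj⟩
  have hj' : ∀ j : ℕ, ∃ T₀ : ℝ, 0 < T₀ ∧
      ∃ (K : ℝ → ℕ) (u₀ : UnitAddTorus (Fin 3) → EuclideanSpace ℝ (Fin 3))
        (u : ℝ → UnitAddTorus (Fin 3) → EuclideanSpace ℝ (Fin 3)),
        ∫ x, ‖u₀ x‖ ^ 2 ≤ E₀ ∧ Torus.IsGlobalLerayHopf (ν (j + j₀)) (fun _ => f) u₀ u ∧
        (∀ T : ℝ, T₀ ≤ T → timeMean (fun t => ∫ x, ‖u t x‖ ^ 2) T ≤ E) ∧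
        (∀ T' : ℝ, ∃ T : ℝ, T' ≤ T ∧
          ε ≤ timeMean (fun t => (ν (j + j₀)) *
            (Torus.eGradNormSq (Torus.fourierTruncate (K T) (u t))).toReal) T) :=
    fun j => hj (j + j₀) (Nat.le_add_left j₀ j)
  choose T₀ hT₀ K u₀ u hcap hLH hE hR using hj'
  refine ⟨f, hf, hdiv, hmean, fun j => ν (j + j₀), u₀, u, fun j => hν (j + j₀),
    (tendsto_add_atTop_iff_nat j₀).2 hν0, hLH, ⟨E, fun j => ?_⟩, ε, hε, fun j => ?_⟩
  · -- mean energy: eventual bound ⇒ limsup bound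
    show limsup (timeMean fun t => ∫ x, ‖u j t x‖ ^ 2) atTop ≤ E
    exact Filter.limsup_le_of_le
      (isCoboundedUnder_le_timeMean_of_nonneg fun t => integral_nonneg fun x => by positivity)
      ((eventually_ge_atTop (T₀ j)).mono fun T hT => hE j T hT)
  · -- mean dissipation: frequently loud ⇒ limsup ≥ ε
    show ε ≤ limsup (timeMean fun t => ν (j + j₀) * (Torus.eGradNormSq (u j t)).toReal) atTop
    refine Filter.le_limsup_of_frequently_le ?_
      (Torus.IsGlobalLerayHopf.isBoundedUnder_timeMean_dissipation (hν _) (hf.memLp 2) hmean (hLH j))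
    refine Filter.frequently_atTop.2 fun T' => ?_
    obtain ⟨T, hT, hloud⟩ := hR j (max T' 1)
    have hTpos : 0 < T := lt_of_lt_of_le one_pos ((le_max_right _ _).trans hT)
    exact ⟨T, (le_max_left _ _).trans hT,
      hloud.trans (timeMean_resolvedDissipation_le (hν _).le (hLH j) (K j T) hTpos)⟩

end Summit.AnomalousDissipation.AnomalousDissipation.Theorems.WindowBookkeeping

end
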